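import Literature.NumberTheory.LFunctions.BeurlingDilationTransforms
import Literature.Analysis.Complex.EntireQuotientOrder
import Mathlib.Analysis.Complex.PhragmenLindelof
import Mathlib.Analysis.Complex.RemovableSingularity
import Mathlib.Analysis.Complex.Liouville
import HarnessLib

/-!
# RH-FREE · Beurling's Mellin continuation argument (Math. Scand. 1953 Thm I, as used in PNAS 1955): an annihilator of the dilated two-point functions with a zero-free hypothesis as an EXPLICIT ASSUMPTION has `∫₀¹ g = 0` — nothing here bears on the truth of RH

LABEL (line 1): RH-FREE. The main theorem `integral_eq_zero_of_annihilator` carries the zero-free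
half-plane `ζ(w) ≠ 0, Re w > 1 − a` as a HYPOTHESIS `hZ` (it is applied with `a = 1/q`,
`1 − a = 1/p` in `BeurlingClosureLpNecessityProofs.lean`); nothing is asserted about the zeros of
`ζ`. All other statements are unconditional complex analysis. Nothing here asserts RH or its
negation; nothing here bears on the truth of RH.

Second of three files discharging `Beurling1955_closure_iff` (see `BeurlingDilationTransforms.lean`
for the sources read: [Beurling1955] PNAS 41 pp. 312–314 in full; [Beurling1953] Math. Scand. 1
Theorem I, pp. 127–130).

## The printed argument and this file's rendering of it

Beurling 1953, proof of Theorem I: with `γ(ξ) = ∫ k(x) g(ξx) dx = 0` for `ξ ≤ 1`, the Mellin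
transforms satisfy `G = K · F` on a vertical strip (eq. (4)); `G` and `K` are analytic and of
controlled growth on a left half-plane, `F` on a right half-plane; `F := G/K` continues `F` to an
entire function provided the zeros of `K` are crossed; Phragmén–Lindelöf and the decay of `F` force
`F ≡ 0`. Beurling crosses the zeros of `K` with the Nevanlinna factorisation; here `K = K_θ` is
explicit (`BeurlingDilationTransforms.twoPointMellin_eq`), so:

* §1 tools: `log_norm_le_ratio_of_mul_eq` — Poisson–Jensen growth of a holomorphic quotient on discs
  with flexible radii `r < R₁ < R₂` (the tree's `EntireQuotientOrder` machinery
  [cite: RubelColliander1996, Ch. 8]); real values of `ζ`: `1 ≤ ζ(σ)`, antitone in `σ > 1`,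
  `‖ζ(σ+it)‖ ≥ ζ(2σ)/ζ(σ)` (from the tree's Euler-product lower bound).
* §2 zero bookkeeping under the hypothesis `hZ`: in `Re s < 1` the zeros of `K_θ` are the zeros of
  `ζ(1−s)` with `Re s ≥ a` (inside the strip where `F` is already analytic) or points of `Re s = 0`
  with `θ^{s} = 1`; the two-θ trick (`θ₁ = e^{−1}`, `θ₂ = e^{−√2}`, `cross_identity :
  G_θ₁ K_θ₂ = G_θ₂ K_θ₁` by the identity theorem) leaves only `s = 0`, where `K_θ(0) = −θ log θ ≠ 0`.
  Local boundedness of the quotient near every point of `Re s < 1` (`bdd_near_*`, including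
  Beurling's "no pole on the line `Re s = a`" via the rate hypothesis `hrate`:
  `‖F(σ+it)‖ = O((σ−a)^{−κ})`, `κ < 1`, beats a pole of order ≥ 1), removable singularities
  (`exists_continuation`), `exists_entire`.
* §3 growth: `log_norm_le_on_disc` / `norm_le_exp_of_re_le` (at most exponential-in-`|t|^N` growth on
  the left, from §1 with `h = K_θ`, `|K_θ| ≤ 2/(1−σ)`, and the lower bound for `K_θ` at centres
  `Re c < 0`), boundedness on the right half-plane and on the real ray (`norm_le_on_ray`), then
  Mathlib's `PhragmenLindelof` on a half-plane + Liouville: the entire continuation is constant, and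
  `F(σ) → 0` (`tendsto_genMellin_atTop`) gives `F(1) = ∫₀¹ g = 0`:
  `integral_eq_zero_of_annihilator`.

## References

* [Beurling1953] A. Beurling, *A theorem on functions defined on a semi-group*, Math. Scand. 1 (1953)
  127–130, Theorem I and its proof.
* [Beurling1955] A. Beurling, Proc. Nat. Acad. Sci. U.S.A. 41 (1955) 312–314, p. 314.
* [RubelColliander1996] L. Rubel, J. Colliander, *Entire and Meromorphic Functions*, Springer 1996,
  Ch. 8 (Poisson–Jensen).
-/

noncomputable section

open MeasureTheory Set Complex Filter Topology Real Metric
open scoped ENNReal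

namespace Literature.NumberTheory.LFunctions

namespace Beurling1955

/-! ## §1 Tools: the disc estimate for holomorphic quotients with flexible radii; real values of `ζ` -/

/-- **Growth of a holomorphic quotient on a disc, flexible radii** (the tree's
`log_norm_le_three_mul_of_mul_eq` with radii `r < R₁ < R₂` in place of `r < 2r < 3r`): if `h, F` are
holomorphic about `|z − c| ≤ R₂` with `F · h = g` there, `h(c) ≠ 0`, `|g| ≤ M_g`, `|h| ≤ M_h` on
that disc, then `log|F(w)| ≤ ((R₂ + r)/(R₁ − r)) (log⁺ M_g + log⁺ M_h − log|h(c)|)` for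
`|w − c| ≤ r` (Poisson–Jensen at a radius `R ∈ (R₁, R₂)` avoiding the zeros of `F h`).
[cite: RubelColliander1996, Ch. 8 Theorem (p. 23)] -/
theorem log_norm_le_ratio_of_mul_eq {g h F : ℂ → ℂ} {c : ℂ} {r R₁ R₂ Mg Mh : ℝ} (hr : 0 ≤ r)
    (hrR : r < R₁) (hR : R₁ < R₂)
    (hh : AnalyticOnNhd ℂ h (closedBall c R₂)) (hF : AnalyticOnNhd ℂ F (closedBall c R₂))
    (hq : ∀ z ∈ closedBall c R₂, F z * h z = g z) (hhc : h c ≠ 0)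
    (hMg : ∀ z ∈ closedBall c R₂, ‖g z‖ ≤ Mg) (hMh : ∀ z ∈ closedBall c R₂, ‖h z‖ ≤ Mh)
    {w : ℂ} (hw : w ∈ closedBall c r) :
    Real.log ‖F w‖ ≤ (R₂ + r) / (R₁ - r) * (log⁺ Mg + log⁺ Mh - Real.log ‖h c‖) := by
  have hR₂ : 0 < R₂ := by linarith
  have hc3 : c ∈ closedBall c R₂ := mem_closedBall_self hR₂.le
  have hX : 0 ≤ log⁺ Mg + log⁺ Mh - Real.log ‖h c‖ := by
    have h1 : Real.log ‖h c‖ ≤ log⁺ ‖h c‖ := by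
      rw [posLog_def]; exact le_max_right _ _
    have h2 : log⁺ ‖h c‖ ≤ log⁺ Mh := posLog_le_posLog (norm_nonneg _) (hMh c hc3)
    linarith [posLog_nonneg (x := Mg)]
  have hwc : ‖w - c‖ ≤ r := by rwa [mem_closedBall, dist_eq_norm] at hw
  have hw3 : w ∈ closedBall c R₂ := closedBall_subset_closedBall (by linarith) hw
  by_cases hFw : F w = 0
  · rw [hFw, norm_zero, Real.log_zero]
    exact mul_nonneg (div_nonneg (by linarith) (by linarith)) hX
  have hfin : ({u : ℂ | u ∈ closedBall c R₂ ∧ F u = 0} ∪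
      {u : ℂ | u ∈ closedBall c R₂ ∧ h u = 0}).Finite :=
    (Literature.Analysis.Complex.finite_zeros_of_analyticOnNhd_closedBall hF ⟨w, hw3, hFw⟩).union
      (Literature.Analysis.Complex.finite_zeros_of_analyticOnNhd_closedBall hh ⟨c, hc3, hhc⟩)
  obtain ⟨R, ⟨hR2, hR3⟩, hRS⟩ := (Set.Ioo_infinite hR).exists_notMem_finset
    (hfin.toFinset.image fun u ↦ ‖u - c‖)
  have hR0 : 0 < R := by linarith
  have hsub : closedBall c R ⊆ closedBall c R₂ := closedBall_subset_closedBall hR3.le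
  have hsph : sphere c R ⊆ closedBall c R₂ := sphere_subset_closedBall.trans hsub
  have havoid : ∀ z ∈ sphere c R, F z ≠ 0 ∧ h z ≠ 0 := by
    intro z hz
    have hzR : ‖z - c‖ = R := by rwa [mem_sphere, dist_eq_norm] at hz
    have hz3 : z ∈ closedBall c R₂ := hsph hz
    constructor
    · intro h0
      exact hRS (Finset.mem_image.mpr ⟨z, hfin.mem_toFinset.mpr (Or.inl ⟨hz3, h0⟩), hzR⟩)
    · intro h0
      exact hRS (Finset.mem_image.mpr ⟨z, hfin.mem_toFinset.mpr (Or.inr ⟨hz3, h0⟩), hzR⟩)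
  have hwball : w ∈ ball c R := by
    rw [mem_ball, dist_eq_norm]; linarith
  have key := Literature.Analysis.Complex.log_norm_le_ratio_mul_of_mul_eq hR0 (hh.mono hsub)
    (hF.mono hsub) (fun z hz ↦ hq z (hsph hz)) hhc (fun z hz ↦ (havoid z hz).2)
    (fun z hz ↦ (havoid z hz).1) (fun z hz ↦ hMg z (hsph hz)) (fun z hz ↦ hMh z (hsph hz)) hwball
  refine key.trans (mul_le_mul_of_nonneg_right ?_ hX)
  rw [div_le_div_iff₀ (by linarith) (by linarith)]
  nlinarith

/-- `ζ(u) = ∑ (n+1)^{-u}` as a real series for real `u > 1`: the real part is the real sum and the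
imaginary part vanishes. [folklore] -/
private theorem riemannZeta_ofReal_eq_tsum {u : ℝ} (hu : 1 < u) :
    riemannZeta (u : ℂ) = ((∑' n : ℕ, ((n : ℝ) + 1) ^ (-u) : ℝ) : ℂ) := by
  have hu' : 1 < (u : ℂ).re := by simpa using hu
  rw [zeta_eq_tsum_one_div_nat_add_one_cpow hu']
  have hterm : ∀ n : ℕ, (1 / ((n : ℂ) + 1) ^ (u : ℂ)) = ((((n : ℝ) + 1) ^ (-u) : ℝ) : ℂ) := by
    intro n
    have : ((n : ℂ) + 1) = (((n : ℝ) + 1 : ℝ) : ℂ) := by push_cast; ring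
    rw [this, ← Complex.ofReal_cpow (by positivity), one_div, Real.rpow_neg (by positivity),
      Complex.ofReal_inv]
  simp_rw [hterm]
  rw [Complex.ofReal_tsum]

/-- The real series `∑ (n+1)^{-u}` is summable for `u > 1`. [folklore] -/
private theorem summable_nat_add_one_rpow_neg' {u : ℝ} (hu : 1 < u) :
    Summable fun n : ℕ ↦ ((n : ℝ) + 1) ^ (-u) := by
  have := (Real.summable_nat_rpow (p := -u)).2 (by linarith)
  rw [← summable_nat_add_iff 1] at this
  refine this.congr fun n => ?_
  push_cast
  ring_nf

/-- `1 ≤ ζ(u)` and `ζ(u)` is real for real `u > 1`; `‖ζ(u)‖ = ∑ (n+1)^{-u}`. [folklore] -/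
private theorem norm_riemannZeta_ofReal_eq_tsum {u : ℝ} (hu : 1 < u) :
    ‖riemannZeta (u : ℂ)‖ = ∑' n : ℕ, ((n : ℝ) + 1) ^ (-u) := by
  rw [riemannZeta_ofReal_eq_tsum hu, Complex.norm_real, Real.norm_eq_abs, abs_of_nonneg]
  exact tsum_nonneg fun n => Real.rpow_nonneg (by positivity) _

/-- `1 ≤ ‖ζ(u)‖` for real `u > 1` (the term `n = 0`). [folklore] -/
private theorem one_le_norm_riemannZeta_ofReal {u : ℝ} (hu : 1 < u) : 1 ≤ ‖riemannZeta (u : ℂ)‖ := by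
  rw [norm_riemannZeta_ofReal_eq_tsum hu]
  have hs := summable_nat_add_one_rpow_neg' hu
  have h0 : ((0 : ℕ) : ℝ) + 1 = 1 := by simp
  calc (1 : ℝ) = ∑ n ∈ Finset.range 1, ((n : ℝ) + 1) ^ (-u) := by simp
    _ ≤ ∑' n : ℕ, ((n : ℝ) + 1) ^ (-u) :=
        hs.sum_le_tsum _ fun n _ => Real.rpow_nonneg (by positivity) _

/-- `‖ζ(·)‖` is non-increasing on the real axis beyond `1`. [folklore] -/
private theorem norm_riemannZeta_ofReal_antitone {u v : ℝ} (hu : 1 < u) (huv : u ≤ v) :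
    ‖riemannZeta (v : ℂ)‖ ≤ ‖riemannZeta (u : ℂ)‖ := by
  have hv : 1 < v := lt_of_lt_of_le hu huv
  rw [norm_riemannZeta_ofReal_eq_tsum hu, norm_riemannZeta_ofReal_eq_tsum hv]
  refine Summable.tsum_le_tsum (fun n ↦ ?_) (summable_nat_add_one_rpow_neg' hv)
    (summable_nat_add_one_rpow_neg' hu)
  exact Real.rpow_le_rpow_of_exponent_le (by linarith) (by linarith)

/-- **Uniform lower bound for `ζ` to the right of `Re w = 2`**: `‖ζ(w)‖ ≥ 1/ζ(2)` for `Re w ≥ 2`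
(`‖ζ(w)‖ ≥ ζ(2σ)/ζ(σ) ≥ 1/ζ(σ) ≥ 1/ζ(2)`). [cite: Titchmarsh1986, Thm. 8.7] -/
theorem norm_riemannZeta_ge_inv_zeta_two {w : ℂ} (hw : 2 ≤ w.re) :
    1 / ‖riemannZeta ((2 : ℝ) : ℂ)‖ ≤ ‖riemannZeta w‖ := by
  have hw1 : 1 < w.re := by linarith
  have h := norm_riemannZeta_ge_div hw1
  have h2σ : 1 ≤ ‖riemannZeta ((2 * w.re : ℝ) : ℂ)‖ := one_le_norm_riemannZeta_ofReal (by linarith)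
  have hσ : ‖riemannZeta ((w.re : ℝ) : ℂ)‖ ≤ ‖riemannZeta ((2 : ℝ) : ℂ)‖ :=
    norm_riemannZeta_ofReal_antitone (by norm_num) hw
  have hσpos : 0 < ‖riemannZeta ((w.re : ℝ) : ℂ)‖ :=
    lt_of_lt_of_le zero_lt_one (one_le_norm_riemannZeta_ofReal hw1)
  have h2pos : 0 < ‖riemannZeta ((2 : ℝ) : ℂ)‖ :=
    lt_of_lt_of_le zero_lt_one (one_le_norm_riemannZeta_ofReal (by norm_num))
  calc 1 / ‖riemannZeta ((2 : ℝ) : ℂ)‖ ≤ 1 / ‖riemannZeta ((w.re : ℝ) : ℂ)‖ :=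
        one_div_le_one_div_of_le hσpos hσ
    _ ≤ ‖riemannZeta ((2 * w.re : ℝ) : ℂ)‖ / ‖riemannZeta ((w.re : ℝ) : ℂ)‖ := by
        gcongr
    _ ≤ ‖riemannZeta w‖ := h


/-! ## §2 The two kernels `K₁ = K_{e^{-1}}`, `K₂ = K_{e^{-√2}}`: analyticity, isolated zeros, the cross identity `K₂ G₁ = K₁ G₂`, and the zeros of `K₁` under a zero-free half-plane -/

/-- `0 < e^{-1} < 1`. [folklore] -/
private theorem theta_one_mem : 0 < Real.exp (-1) ∧ Real.exp (-1) < 1 :=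
  ⟨Real.exp_pos _, Real.exp_lt_one_iff.mpr (by norm_num)⟩

/-- `0 < e^{-√2} < 1`. [folklore] -/
private theorem theta_two_mem : 0 < Real.exp (-Real.sqrt 2) ∧ Real.exp (-Real.sqrt 2) < 1 :=
  ⟨Real.exp_pos _, Real.exp_lt_one_iff.mpr (by
    have : 0 < Real.sqrt 2 := Real.sqrt_pos.mpr (by norm_num); linarith)⟩

/-- The half-plane `U = {Re s < 1}` is open. [folklore] -/
private theorem isOpen_re_lt_one : IsOpen {s : ℂ | s.re < 1} :=
  isOpen_lt Complex.continuous_re continuous_const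

/-- The half-plane `U = {Re s < 1}` is preconnected (convex). [folklore] -/
private theorem isPreconnected_re_lt_one : IsPreconnected {s : ℂ | s.re < 1} :=
  (convex_halfSpace_re_lt (1 : ℝ)).isPreconnected

/-- `K_θ` is analytic on `U` (as `AnalyticOnNhd`). [cite: Beurling1953, proof of Theorem I (K holomorphic in σ < 1/r)] -/
theorem analyticOnNhd_twoPointMellin (θ : ℝ) :
    AnalyticOnNhd ℂ (twoPointMellin θ) {s : ℂ | s.re < 1} :=
  (differentiableOn_twoPointMellin θ).analyticOnNhd isOpen_re_lt_one

/-- `K_θ` (`0 < θ < 1`) is not identically zero near any point of `U`: it does not vanish at `−1`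
and `U` is connected. [cite: Beurling1953, proof of Theorem I ("K(s) ≢ 0")] -/
theorem not_eventually_eq_zero_twoPointMellin {θ : ℝ} (hθ0 : 0 < θ) (hθ1 : θ < 1) {s : ℂ}
    (hs : s.re < 1) : ¬ (∀ᶠ z in 𝓝 s, twoPointMellin θ z = 0) := by
  intro h
  have hall := (analyticOnNhd_twoPointMellin θ).eqOn_zero_of_preconnected_of_eventuallyEq_zero
    isPreconnected_re_lt_one hs h
  have h1 : twoPointMellin θ (-1) = 0 := hall (show ((-1 : ℂ)).re < 1 by simp)
  exact twoPointMellin_ne_zero_of_re_neg hθ0 hθ1 (by simp) h1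

/-- The zeros of `K_θ` in `U` are isolated: `K_θ ≠ 0` on a punctured neighbourhood of every point.
[folklore] -/
private theorem eventually_ne_zero_twoPointMellin {θ : ℝ} (hθ0 : 0 < θ) (hθ1 : θ < 1) {s : ℂ}
    (hs : s.re < 1) : ∀ᶠ z in 𝓝[≠] s, twoPointMellin θ z ≠ 0 :=
  ((analyticOnNhd_twoPointMellin θ s hs).eventually_eq_zero_or_eventually_ne_zero).resolve_left
    (not_eventually_eq_zero_twoPointMellin hθ0 hθ1 hs)

/-- **The cross identity `K_{θ'} G_θ = K_θ G_{θ'}` on `U`**: both sides are holomorphic on the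
connected `U` and equal `K_θ K_{θ'} F` on the strip `a < Re s < 1` (Beurling 1953 eq. (4) for the
two annihilated functions `f_θ`, `f_{θ'}`). [cite: Beurling1953, proof of Theorem I (eq. (4), "not only for the particular k(x) considered, but for any k")] -/
theorem cross_identity {θ θ' : ℝ} (hθ0 : 0 < θ) (hθ1 : θ ≤ 1) (hθ0' : 0 < θ') (hθ1' : θ' ≤ 1)
    {a : ℝ} (ha1 : a < 1) {g : ℝ → ℝ} (hgm : Measurable g) (hg : IntegrableOn g (Ioo (0 : ℝ) 1))
    (hgw : ∀ σ : ℝ, a < σ → IntegrableOn (fun x : ℝ => x ^ (σ - 1) * |g x|) (Ioo (0 : ℝ) 1))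
    (hann : ∀ θ ξ : ℝ, 0 < θ → θ ≤ 1 → 0 < ξ → ξ ≤ 1 →
      ∫ u in Ioo (0 : ℝ) 1, ((twoPoint θ (u / ξ) : ℝ) : ℂ) * (g u : ℂ) = 0) :
    EqOn (fun s => twoPointMellin θ' s * corrMellin θ g s)
      (fun s => twoPointMellin θ s * corrMellin θ' g s) {s : ℂ | s.re < 1} := by
  have hG : ∀ {t : ℝ}, 0 < t → t ≤ 1 → AnalyticOnNhd ℂ (corrMellin t g) {s : ℂ | s.re < 1} :=
    fun ht0 ht1 => (differentiableOn_corrMellin ht0.le ht1 hgm hg (hann _ · ht0 ht1)).analyticOnNhd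
      isOpen_re_lt_one
  have hL : AnalyticOnNhd ℂ (fun s => twoPointMellin θ' s * corrMellin θ g s) {s : ℂ | s.re < 1} :=
    (analyticOnNhd_twoPointMellin θ').mul (hG hθ0 hθ1)
  have hR : AnalyticOnNhd ℂ (fun s => twoPointMellin θ s * corrMellin θ' g s) {s : ℂ | s.re < 1} :=
    (analyticOnNhd_twoPointMellin θ).mul (hG hθ0' hθ1')
  -- a point of the strip
  set z₀ : ℂ := (((a + 1) / 2 : ℝ) : ℂ) with hz₀
  have hz₀re : z₀.re = (a + 1) / 2 := by simp [hz₀]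
  have hz₀U : z₀ ∈ {s : ℂ | s.re < 1} := by simp only [mem_setOf_eq, hz₀re]; linarith
  refine hL.eqOn_of_preconnected_of_eventuallyEq hR isPreconnected_re_lt_one hz₀U ?_
  have hstrip : ∀ᶠ z in 𝓝 z₀, a < z.re ∧ z.re < 1 := by
    have hopen : IsOpen {z : ℂ | a < z.re ∧ z.re < 1} :=
      (isOpen_lt continuous_const Complex.continuous_re).inter isOpen_re_lt_one
    exact hopen.mem_nhds ⟨by simp only [hz₀re]; linarith, by simp only [hz₀re]; linarith⟩
  filter_upwards [hstrip] with z hz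
  rw [corrMellin_eq_mul hθ0.le hθ1 hgm hz.2 (hgw _ hz.1),
    corrMellin_eq_mul hθ0'.le hθ1' hgm hz.2 (hgw _ hz.1)]
  ring

/-- `θ^{1−s} = θ` iff `exp(−s log θ) = 1` (`θ > 0`). [folklore] -/
private theorem cpow_eq_self_iff {θ : ℝ} (hθ0 : 0 < θ) (s : ℂ) :
    (θ : ℂ) ^ (1 - s) = θ ↔ Complex.exp (-s * Real.log θ) = 1 := by
  have hθc : (θ : ℂ) ≠ 0 := by exact_mod_cast hθ0.ne'
  rw [Complex.cpow_def_of_ne_zero hθc,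
    show Complex.log θ * (1 - s) = Complex.log θ + (-s * Complex.log θ) by ring, Complex.exp_add,
    Complex.exp_log hθc, ← Complex.ofReal_log hθ0.le]
  constructor
  · intro h
    exact mul_left_cancel₀ hθc (h.trans (mul_one (θ : ℂ)).symm)
  · intro h
    rw [h, mul_one]

/-- With `θ = e^{−1}`: `θ^{1−s} = θ` iff `s = 2πi k` for some integer `k`. [folklore] -/
private theorem cpow_exp_neg_one_eq_self_iff (s : ℂ) :
    ((Real.exp (-1) : ℝ) : ℂ) ^ (1 - s) = (Real.exp (-1) : ℝ) ↔ ∃ k : ℤ, s = k * (2 * π * I) := by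
  rw [cpow_eq_self_iff (Real.exp_pos _), Real.log_exp]
  push_cast
  rw [show -s * (-1 : ℂ) = s by ring, Complex.exp_eq_one_iff]

/-- With `θ = e^{−√2}`: `θ^{1−s} = θ` iff `s √2 = 2πi k` for some integer `k`. [folklore] -/
private theorem cpow_exp_neg_sqrt_two_eq_self_iff (s : ℂ) :
    ((Real.exp (-Real.sqrt 2) : ℝ) : ℂ) ^ (1 - s) = (Real.exp (-Real.sqrt 2) : ℝ) ↔
      ∃ k : ℤ, s * Real.sqrt 2 = k * (2 * π * I) := by
  rw [cpow_eq_self_iff (Real.exp_pos _), Real.log_exp]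
  push_cast
  rw [show -s * (-(Real.sqrt 2 : ℂ)) = s * Real.sqrt 2 by ring, Complex.exp_eq_one_iff]

/-- **The two kernels `K_{e^{-1}}`, `K_{e^{-√2}}` have no common zero of the first kind off `s = 0`**:
`s = 2πik` and `s√2 = 2πik'` force `s = 0` (irrationality of `√2`). [folklore] -/
private theorem eq_zero_of_two_lattices {s : ℂ} (h1 : ∃ k : ℤ, s = k * (2 * π * I))
    (h2 : ∃ k : ℤ, s * Real.sqrt 2 = k * (2 * π * I)) : s = 0 := by
  obtain ⟨k, hk⟩ := h1
  obtain ⟨k', hk'⟩ := h2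
  have h2πI : (2 * π * I : ℂ) ≠ 0 := by simp [Real.pi_ne_zero, Complex.I_ne_zero]
  rw [hk, mul_assoc, mul_comm (2 * π * I : ℂ), ← mul_assoc] at hk'
  have hkk : (k : ℂ) * Real.sqrt 2 = k' := mul_right_cancel₀ h2πI hk'
  by_cases hk0 : k = 0
  · rw [hk, hk0]; simp
  · exfalso
    have hr : Real.sqrt 2 = (k' : ℝ) / (k : ℝ) := by
      have hkr : (k : ℝ) ≠ 0 := by exact_mod_cast hk0
      have : (k : ℝ) * Real.sqrt 2 = k' := by exact_mod_cast hkk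
      field_simp; linarith
    exact irrational_sqrt_two ⟨(k' : ℚ) / (k : ℚ), by rw [hr]; push_cast; ring⟩

/-- **Zeros of `K₁ = K_{e^{-1}}` left of the line `Re s = a`, under the zero-free hypothesis
`ζ ≠ 0` on `Re w > 1 − a`**: such a zero `s` has `s = 2πik` with `k ≠ 0` — so `Re s = 0` — and
`K₂ = K_{e^{-√2}}` does not vanish there (Beurling 1955: at a zero of the continuation either
`ζ(1−s) = 0`, excluded by the hypothesis, or `θ^{1−s} = θ`, which cannot hold for two
incommensurable `log θ`). [cite: Beurling1955, eq. (9)] -/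
theorem twoPointMellin_two_ne_zero_of_zero {a : ℝ} (ha1 : a < 1)
    (hZ : ∀ w : ℂ, 1 - a < w.re → riemannZeta w ≠ 0) {s : ℂ} (hs : s.re < a)
    (h0 : twoPointMellin (Real.exp (-1)) s = 0) :
    s.re = 0 ∧ twoPointMellin (Real.exp (-Real.sqrt 2)) s ≠ 0 := by
  obtain ⟨h10, h11⟩ := theta_one_mem
  obtain ⟨h20, h21⟩ := theta_two_mem
  have hs1 : s.re < 1 := by linarith
  have hs0 : s ≠ 0 := fun h => twoPointMellin_zero_ne_zero h10 h11 (h ▸ h0)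
  have hζ : riemannZeta (1 - s) ≠ 0 := hZ _ (by simp; linarith)
  rw [twoPointMellin_eq_zero_iff h10 h11.le hs1 hs0] at h0
  have h1 : ((Real.exp (-1) : ℝ) : ℂ) ^ (1 - s) = (Real.exp (-1) : ℝ) := h0.resolve_right hζ
  refine ⟨re_eq_zero_of_cpow_eq h10 h11 h1, fun h2 => ?_⟩
  rw [twoPointMellin_eq_zero_iff h20 h21.le hs1 hs0] at h2
  have h2' := h2.resolve_right hζ
  exact hs0 (eq_zero_of_two_lattices ((cpow_exp_neg_one_eq_self_iff s).mp h1)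
    ((cpow_exp_neg_sqrt_two_eq_self_iff s).mp h2'))


/-! ## §3 Local boundedness of the quotient `G_θ/K_θ` near every point of `U` (Beurling's alternatives) -/

/-- Case (a): near a point where `K_θ ≠ 0` the quotient `G_θ/K_θ` is continuous, hence locally
bounded. [folklore] -/
private theorem bdd_near_of_ne_zero {θ : ℝ} (hθ0 : 0 ≤ θ) (hθ1 : θ ≤ 1) {g : ℝ → ℝ} (hgm : Measurable g)
    (hg : IntegrableOn g (Ioo (0 : ℝ) 1))
    (hann : ∀ ξ : ℝ, 0 < ξ → ξ ≤ 1 →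
      ∫ u in Ioo (0 : ℝ) 1, ((twoPoint θ (u / ξ) : ℝ) : ℂ) * (g u : ℂ) = 0)
    {s₀ : ℂ} (hs₀ : s₀.re < 1) (hK : twoPointMellin θ s₀ ≠ 0) :
    ∃ M : ℝ, ∀ᶠ z in 𝓝[≠] s₀, ‖corrMellin θ g z / twoPointMellin θ z‖ ≤ M := by
  have hU : {s : ℂ | s.re < 1} ∈ 𝓝 s₀ := isOpen_re_lt_one.mem_nhds hs₀
  have hGc : ContinuousAt (corrMellin θ g) s₀ :=
    ((differentiableOn_corrMellin hθ0 hθ1 hgm hg hann).differentiableAt hU).continuousAt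
  have hKc : ContinuousAt (twoPointMellin θ) s₀ :=
    ((differentiableOn_twoPointMellin θ).differentiableAt hU).continuousAt
  have hQ : ContinuousAt (fun z => ‖corrMellin θ g z / twoPointMellin θ z‖) s₀ := (hGc.div hKc hK).norm
  refine ⟨‖corrMellin θ g s₀ / twoPointMellin θ s₀‖ + 1, ?_⟩
  have := hQ.eventually_mem (Iio_mem_nhds (lt_add_one _))
  exact (this.filter_mono nhdsWithin_le_nhds).mono fun z hz => le_of_lt hz

/-- Case (b): **in the strip `a < Re s < 1` the quotient is `F`** (Beurling 1953 eq. (4)), hence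
locally bounded there — in particular near the zeros of `K_θ` inside the strip.
[cite: Beurling1953, proof of Theorem I ("F(s) coincides with G(s)/K(s) in the strip")] -/
theorem bdd_near_of_mem_strip {θ : ℝ} (hθ0 : 0 < θ) (hθ1 : θ < 1) {a : ℝ} {g : ℝ → ℝ}
    (hgm : Measurable g)
    (hgw : ∀ σ : ℝ, a < σ → IntegrableOn (fun x : ℝ => x ^ (σ - 1) * |g x|) (Ioo (0 : ℝ) 1))
    {s₀ : ℂ} (ha : a < s₀.re) (hs₀ : s₀.re < 1) :
    ∃ M : ℝ, ∀ᶠ z in 𝓝[≠] s₀, ‖corrMellin θ g z / twoPointMellin θ z‖ ≤ M := by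
  have hopen : IsOpen {z : ℂ | a < z.re ∧ z.re < 1} :=
    (isOpen_lt continuous_const Complex.continuous_re).inter isOpen_re_lt_one
  have hS : {z : ℂ | a < z.re ∧ z.re < 1} ∈ 𝓝 s₀ := hopen.mem_nhds ⟨ha, hs₀⟩
  have hFc : ContinuousAt (genMellin g) s₀ :=
    ((differentiableOn_genMellin hgm hgw).differentiableAt
      ((isOpen_lt continuous_const Complex.continuous_re).mem_nhds ha)).continuousAt
  refine ⟨‖genMellin g s₀‖ + 1, ?_⟩
  have h1 := (hFc.norm.eventually_mem (Iio_mem_nhds (lt_add_one _))).filter_mono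
    (nhdsWithin_le_nhds (s := ({s₀}ᶜ : Set ℂ)))
  have h2 := eventually_ne_zero_twoPointMellin hθ0 hθ1 hs₀
  have h3 : ∀ᶠ z in 𝓝[≠] s₀, a < z.re ∧ z.re < 1 := mem_nhdsWithin_of_mem_nhds hS
  filter_upwards [h1, h2, h3] with z hz1 hz2 hz3
  rw [corrMellin_eq_mul hθ0.le hθ1.le hgm hz3.2 (hgw _ hz3.1), mul_div_cancel_left₀ _ hz2]
  exact le_of_lt hz1

/-- Case (c): **no pole on the line `Re s = a`** (Beurling 1953: "Due to the inequality
`|F(σ+it)| < const (σ − 1/p)^{-(1−1/p)}`, `F(s)` cannot have any pole on the line `σ = 1/p`").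
If `K_θ(s₀) = 0` with `Re s₀ = a`, `K_θ = (s−s₀)^m u`, `G_θ = (s−s₀)^n h` near `s₀` (`u(s₀), h(s₀) ≠ 0`),
then `n ≥ m`: otherwise `h(s₀+δ) = δ^{m−n} u(s₀+δ) F(s₀+δ) = O(δ^{m−n−κ}) → 0` (`κ < 1 ≤ m−n`),
contradicting `h(s₀) ≠ 0`; so `G_θ/K_θ = (s−s₀)^{n−m} h/u` is bounded near `s₀`.
[cite: Beurling1953, proof of Theorem I ("F(s) cannot have any pole on the line σ = 1/p")] -/
theorem bdd_near_of_zero_on_line {θ : ℝ} (hθ0 : 0 < θ) (hθ1 : θ < 1) {a : ℝ} (ha1 : a < 1)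
    {g : ℝ → ℝ} (hgm : Measurable g) (hg : IntegrableOn g (Ioo (0 : ℝ) 1))
    (hgw : ∀ σ : ℝ, a < σ → IntegrableOn (fun x : ℝ => x ^ (σ - 1) * |g x|) (Ioo (0 : ℝ) 1))
    (hann : ∀ ξ : ℝ, 0 < ξ → ξ ≤ 1 →
      ∫ u in Ioo (0 : ℝ) 1, ((twoPoint θ (u / ξ) : ℝ) : ℂ) * (g u : ℂ) = 0)
    (hrate : ∃ C κ : ℝ, κ < 1 ∧ ∀ σ : ℝ, a < σ → σ ≤ a + 1 →
      ∫ x in Ioo (0 : ℝ) 1, x ^ (σ - 1) * |g x| ≤ C * (σ - a) ^ (-κ))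
    {s₀ : ℂ} (hs₀ : s₀.re = a) :
    ∃ M : ℝ, ∀ᶠ z in 𝓝[≠] s₀, ‖corrMellin θ g z / twoPointMellin θ z‖ ≤ M := by
  have hs₀1 : s₀.re < 1 := by rw [hs₀]; exact ha1
  have hU : {s : ℂ | s.re < 1} ∈ 𝓝 s₀ := isOpen_re_lt_one.mem_nhds hs₀1
  have hKan : AnalyticAt ℂ (twoPointMellin θ) s₀ := analyticOnNhd_twoPointMellin θ s₀ hs₀1
  have hGan : AnalyticAt ℂ (corrMellin θ g) s₀ :=
    ((differentiableOn_corrMellin hθ0.le hθ1.le hgm hg hann).analyticOnNhd isOpen_re_lt_one) s₀ hs₀1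
  obtain ⟨m, u, hu_an, hu0, hKev⟩ := hKan.exists_eventuallyEq_pow_smul_nonzero_iff.mpr
    (not_eventually_eq_zero_twoPointMellin hθ0 hθ1 hs₀1)
  have hKne := eventually_ne_zero_twoPointMellin hθ0 hθ1 hs₀1
  by_cases hG0 : ∀ᶠ z in 𝓝 s₀, corrMellin θ g z = 0
  · refine ⟨0, ?_⟩
    filter_upwards [hG0.filter_mono nhdsWithin_le_nhds] with z hz
    rw [hz, zero_div, norm_zero]
  obtain ⟨n, h, hh_an, hh0, hGev⟩ := hGan.exists_eventuallyEq_pow_smul_nonzero_iff.mpr hG0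
  obtain ⟨C, κ, hκ, hC⟩ := hrate
  -- Step 1: `m ≤ n`, by Beurling's growth argument along `s₀ + δ`, `δ ↓ 0`.
  have hmn : m ≤ n := by
    by_contra hlt
    rw [not_le] at hlt
    -- the path `δ ↦ s₀ + δ`
    have hpath : Tendsto (fun δ : ℝ => s₀ + (δ : ℂ)) (𝓝[>] (0 : ℝ)) (𝓝 s₀) := by
      have : Tendsto (fun δ : ℝ => s₀ + (δ : ℂ)) (𝓝 (0 : ℝ)) (𝓝 (s₀ + ((0 : ℝ) : ℂ))) :=
        ((continuous_const.add Complex.continuous_ofReal).tendsto 0)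
      simp only [Complex.ofReal_zero, add_zero] at this
      exact this.mono_left nhdsWithin_le_nhds
    have hu_c : Tendsto (fun δ : ℝ => u (s₀ + δ)) (𝓝[>] (0 : ℝ)) (𝓝 (u s₀)) :=
      hu_an.continuousAt.tendsto.comp hpath
    have hh_c : Tendsto (fun δ : ℝ => h (s₀ + δ)) (𝓝[>] (0 : ℝ)) (𝓝 (h s₀)) :=
      hh_an.continuousAt.tendsto.comp hpath
    -- eventual identities along the path
    have e1 : ∀ᶠ δ : ℝ in 𝓝[>] 0, twoPointMellin θ (s₀ + δ) = ((δ : ℂ)) ^ m * u (s₀ + δ) := by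
      filter_upwards [hpath.eventually hKev] with δ hδ
      rw [hδ, smul_eq_mul, add_sub_cancel_left]
    have e2 : ∀ᶠ δ : ℝ in 𝓝[>] 0, corrMellin θ g (s₀ + δ) = ((δ : ℂ)) ^ n * h (s₀ + δ) := by
      filter_upwards [hpath.eventually hGev] with δ hδ
      rw [hδ, smul_eq_mul, add_sub_cancel_left]
    have e3 : ∀ᶠ δ : ℝ in 𝓝[>] 0, 0 < δ ∧ δ < min (1 - a) 1 := by
      have : Ioo (0 : ℝ) (min (1 - a) 1) ∈ 𝓝[>] (0 : ℝ) :=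
        Ioo_mem_nhdsGT (lt_min (by linarith) zero_lt_one)
      filter_upwards [this] with δ hδ using hδ
    -- the bound for `h` along the path
    have hbound : ∀ᶠ δ : ℝ in 𝓝[>] 0,
        ‖h (s₀ + δ)‖ ≤ C * ‖u (s₀ + δ)‖ * δ ^ (((m - n : ℕ) : ℝ) - κ) := by
      filter_upwards [e1, e2, e3] with δ hδ1 hδ2 ⟨hδ0, hδa'⟩
      have hδa : δ < 1 - a := lt_of_lt_of_le hδa' (min_le_left _ _)
      have hδ1' : δ ≤ 1 := (lt_of_lt_of_le hδa' (min_le_right _ _)).le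
      have hre : (s₀ + (δ : ℂ)).re = a + δ := by simp [hs₀]
      have hlt1 : (s₀ + (δ : ℂ)).re < 1 := by rw [hre]; linarith
      have hgt : a < (s₀ + (δ : ℂ)).re := by rw [hre]; linarith
      have hrel := corrMellin_eq_mul hθ0.le hθ1.le hgm hlt1 (hgw _ hgt)
      rw [hδ1, hδ2] at hrel
      -- `h(s₀+δ) = δ^{m-n} u F`
      have hδc : ((δ : ℂ)) ≠ 0 := by exact_mod_cast hδ0.ne'
      have hh_eq : h (s₀ + δ) = (δ : ℂ) ^ (m - n) * u (s₀ + δ) * genMellin g (s₀ + δ) := by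
        have hmn' : m = n + (m - n) := by omega
        rw [hmn', pow_add, mul_assoc, mul_assoc] at hrel
        have := mul_left_cancel₀ (pow_ne_zero n hδc) hrel
        rw [this]; ring
      -- the bound on `F`
      have hF : ‖genMellin g (s₀ + δ)‖ ≤ C * δ ^ (-κ) := by
        refine (norm_genMellin_le g _).trans ?_
        have := hC (a + δ) (by linarith) (by linarith)
        rw [hre, show a + δ - a = δ by ring] at *
        exact this
      rw [hh_eq, norm_mul, norm_mul, Complex.norm_pow, Complex.norm_real, Real.norm_eq_abs,
        abs_of_pos hδ0]
      have hsplit : δ ^ (((m - n : ℕ) : ℝ) - κ) = δ ^ (m - n) * δ ^ (-κ) := by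
        rw [Real.rpow_sub hδ0, Real.rpow_natCast, Real.rpow_neg hδ0.le, div_eq_mul_inv]
      rw [hsplit]
      have hu0' : 0 ≤ ‖u (s₀ + ↑δ)‖ := norm_nonneg _
      have hp0 : 0 ≤ δ ^ (m - n) := pow_nonneg hδ0.le _
      calc δ ^ (m - n) * ‖u (s₀ + ↑δ)‖ * ‖genMellin g (s₀ + ↑δ)‖
          ≤ δ ^ (m - n) * ‖u (s₀ + ↑δ)‖ * (C * δ ^ (-κ)) := by gcongr
        _ = C * ‖u (s₀ + ↑δ)‖ * (δ ^ (m - n) * δ ^ (-κ)) := by ring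
    -- the right-hand side tends to `0`
    have hexp : 0 < ((m - n : ℕ) : ℝ) - κ := by
      have : (1 : ℝ) ≤ ((m - n : ℕ) : ℝ) := by
        have : 1 ≤ m - n := by omega
        exact_mod_cast this
      linarith
    have hpow : Tendsto (fun δ : ℝ => δ ^ (((m - n : ℕ) : ℝ) - κ)) (𝓝[>] 0) (𝓝 0) := by
      have hc := Real.continuousAt_rpow_const 0 (((m - n : ℕ) : ℝ) - κ) (Or.inr hexp.le)
      have h0 : (0 : ℝ) ^ (((m - n : ℕ) : ℝ) - κ) = 0 := Real.zero_rpow hexp.ne'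
      rw [ContinuousAt, h0] at hc
      exact hc.mono_left nhdsWithin_le_nhds
    have hR : Tendsto (fun δ : ℝ => C * ‖u (s₀ + δ)‖ * δ ^ (((m - n : ℕ) : ℝ) - κ)) (𝓝[>] 0)
        (𝓝 0) := by
      have := (hu_c.norm.const_mul C).mul hpow
      simpa using this
    have hh0' : Tendsto (fun δ : ℝ => h (s₀ + δ)) (𝓝[>] (0 : ℝ)) (𝓝 0) :=
      squeeze_zero_norm' hbound hR
    exact hh0 (tendsto_nhds_unique hh_c hh0')
  -- Step 2: the quotient is `(z - s₀)^(n-m) h/u` near `s₀`, which is continuous at `s₀`.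
  obtain ⟨k, hk⟩ := Nat.exists_eq_add_of_le hmn
  have hu_ne : ∀ᶠ z in 𝓝 s₀, u z ≠ 0 := hu_an.continuousAt.eventually_ne hu0
  set R : ℂ → ℂ := fun z => (z - s₀) ^ k * h z / u z with hR
  have hRc : ContinuousAt R s₀ :=
    (((continuousAt_id.sub continuousAt_const).pow _).mul hh_an.continuousAt).div
      hu_an.continuousAt hu0
  refine ⟨‖R s₀‖ + 1, ?_⟩
  have hb := (hRc.norm.eventually_mem (Iio_mem_nhds (lt_add_one _))).filter_mono
    (nhdsWithin_le_nhds (s := ({s₀}ᶜ : Set ℂ)))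
  filter_upwards [hb, hKne, hKev.filter_mono nhdsWithin_le_nhds,
    hGev.filter_mono nhdsWithin_le_nhds, hu_ne.filter_mono nhdsWithin_le_nhds,
    self_mem_nhdsWithin] with z hz hKz hKz' hGz' huz hzs
  have hzs' : z - s₀ ≠ 0 := sub_ne_zero.mpr hzs
  have heq : corrMellin θ g z / twoPointMellin θ z = R z := by
    rw [hKz', hGz', smul_eq_mul, smul_eq_mul, hR, hk, pow_add]
    have hp : (z - s₀) ^ m ≠ 0 := pow_ne_zero m hzs'
    field_simp
  rw [heq]
  exact le_of_lt hz

/-- Case (d): **left of the line** (`Re s₀ < a`): a zero of `K₁` there is `2πik`, where `K₂ ≠ 0`,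
and `G₁/K₁ = G₂/K₂` nearby by the cross identity; so the quotient is bounded near `s₀`.
[cite: Beurling1955, eq. (9) and proof (the continuation does not depend on the annihilated function)] -/
theorem bdd_near_of_zero_left {a : ℝ} (ha1 : a < 1) {g : ℝ → ℝ} (hgm : Measurable g)
    (hg : IntegrableOn g (Ioo (0 : ℝ) 1))
    (hgw : ∀ σ : ℝ, a < σ → IntegrableOn (fun x : ℝ => x ^ (σ - 1) * |g x|) (Ioo (0 : ℝ) 1))
    (hann : ∀ θ ξ : ℝ, 0 < θ → θ ≤ 1 → 0 < ξ → ξ ≤ 1 →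
      ∫ u in Ioo (0 : ℝ) 1, ((twoPoint θ (u / ξ) : ℝ) : ℂ) * (g u : ℂ) = 0)
    (hZ : ∀ w : ℂ, 1 - a < w.re → riemannZeta w ≠ 0) {s₀ : ℂ} (hs₀ : s₀.re < a)
    (hK0 : twoPointMellin (Real.exp (-1)) s₀ = 0) :
    ∃ M : ℝ, ∀ᶠ z in 𝓝[≠] s₀,
      ‖corrMellin (Real.exp (-1)) g z / twoPointMellin (Real.exp (-1)) z‖ ≤ M := by
  obtain ⟨h10, h11⟩ := theta_one_mem
  obtain ⟨h20, h21⟩ := theta_two_mem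
  have hs₀1 : s₀.re < 1 := by linarith
  have hU : {s : ℂ | s.re < 1} ∈ 𝓝 s₀ := isOpen_re_lt_one.mem_nhds hs₀1
  obtain ⟨-, hK2⟩ := twoPointMellin_two_ne_zero_of_zero ha1 hZ hs₀ hK0
  have hG2c : ContinuousAt (corrMellin (Real.exp (-Real.sqrt 2)) g) s₀ :=
    ((differentiableOn_corrMellin h20.le h21.le hgm hg
      (fun ξ => hann _ ξ h20 h21.le)).differentiableAt hU).continuousAt
  have hK2c : ContinuousAt (twoPointMellin (Real.exp (-Real.sqrt 2))) s₀ :=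
    ((differentiableOn_twoPointMellin _).differentiableAt hU).continuousAt
  have hRc := (hG2c.div hK2c hK2).norm
  refine ⟨‖corrMellin (Real.exp (-Real.sqrt 2)) g s₀ / twoPointMellin (Real.exp (-Real.sqrt 2)) s₀‖ + 1,
    ?_⟩
  have hb := (hRc.eventually_mem (Iio_mem_nhds (lt_add_one _))).filter_mono
    (nhdsWithin_le_nhds (s := ({s₀}ᶜ : Set ℂ)))
  have hK1ne := eventually_ne_zero_twoPointMellin h10 h11 hs₀1
  have hK2ne : ∀ᶠ z in 𝓝[≠] s₀, twoPointMellin (Real.exp (-Real.sqrt 2)) z ≠ 0 :=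
    (hK2c.eventually_ne hK2).filter_mono nhdsWithin_le_nhds
  have hUev : ∀ᶠ z in 𝓝[≠] s₀, z.re < 1 := mem_nhdsWithin_of_mem_nhds hU
  have hcross := cross_identity h10 h11.le h20 h21.le ha1 hgm hg hgw hann
  filter_upwards [hb, hK1ne, hK2ne, hUev] with z hz hz1 hz2 hzU
  have hx := hcross hzU
  simp only at hx
  have heq : corrMellin (Real.exp (-1)) g z / twoPointMellin (Real.exp (-1)) z =
      corrMellin (Real.exp (-Real.sqrt 2)) g z / twoPointMellin (Real.exp (-Real.sqrt 2)) z := by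
    rw [div_eq_div_iff hz1 hz2]
    linear_combination hx
  rw [heq]
  exact le_of_lt hz


/-! ## §4 The meromorphic continuation of `F` is entire (Beurling 1953: "F(s) can be continued analytically across the line σ = 1/p and is meromorphic for |s| < ∞", here with no poles under the zero-free hypothesis) -/

/-- **Local data at every point of `U`** for `Q = G₁/K₁`: a neighbourhood `V ⊆ U` of `s₀` on which,
off `s₀`, `K₁ ≠ 0` and `Q` is bounded. [cite: Beurling1953, proof of Theorem I (the two alternatives)] -/
theorem exists_nhds_bdd {a : ℝ} (ha1 : a < 1) {g : ℝ → ℝ} (hgm : Measurable g)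
    (hg : IntegrableOn g (Ioo (0 : ℝ) 1))
    (hgw : ∀ σ : ℝ, a < σ → IntegrableOn (fun x : ℝ => x ^ (σ - 1) * |g x|) (Ioo (0 : ℝ) 1))
    (hann : ∀ θ ξ : ℝ, 0 < θ → θ ≤ 1 → 0 < ξ → ξ ≤ 1 →
      ∫ u in Ioo (0 : ℝ) 1, ((twoPoint θ (u / ξ) : ℝ) : ℂ) * (g u : ℂ) = 0)
    (hrate : ∃ C κ : ℝ, κ < 1 ∧ ∀ σ : ℝ, a < σ → σ ≤ a + 1 →
      ∫ x in Ioo (0 : ℝ) 1, x ^ (σ - 1) * |g x| ≤ C * (σ - a) ^ (-κ))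
    (hZ : ∀ w : ℂ, 1 - a < w.re → riemannZeta w ≠ 0) {s₀ : ℂ} (hs₀ : s₀.re < 1) :
    ∃ V ∈ 𝓝 s₀, V ⊆ {s : ℂ | s.re < 1} ∧
      (∀ z ∈ V \ {s₀}, twoPointMellin (Real.exp (-1)) z ≠ 0) ∧
      ∃ M : ℝ, ∀ z ∈ V \ {s₀},
        ‖corrMellin (Real.exp (-1)) g z / twoPointMellin (Real.exp (-1)) z‖ ≤ M := by
  obtain ⟨h10, h11⟩ := theta_one_mem
  have hann1 : ∀ ξ : ℝ, 0 < ξ → ξ ≤ 1 →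
      ∫ u in Ioo (0 : ℝ) 1, ((twoPoint (Real.exp (-1)) (u / ξ) : ℝ) : ℂ) * (g u : ℂ) = 0 :=
    fun ξ => hann _ ξ h10 h11.le
  -- local boundedness, by cases
  have hbdd : ∃ M : ℝ, ∀ᶠ z in 𝓝[≠] s₀,
      ‖corrMellin (Real.exp (-1)) g z / twoPointMellin (Real.exp (-1)) z‖ ≤ M := by
    by_cases hK : twoPointMellin (Real.exp (-1)) s₀ = 0
    · rcases lt_trichotomy s₀.re a with hlt | heq | hgt
      · exact bdd_near_of_zero_left ha1 hgm hg hgw hann hZ hlt hK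
      · exact bdd_near_of_zero_on_line h10 h11 ha1 hgm hg hgw hann1 hrate heq
      · exact bdd_near_of_mem_strip h10 h11 hgm hgw hgt hs₀
    · exact bdd_near_of_ne_zero h10.le h11.le hgm hg hann1 hs₀ hK
  obtain ⟨M, hM⟩ := hbdd
  have hne := eventually_ne_zero_twoPointMellin h10 h11 hs₀
  obtain ⟨V₁, hV₁, hV₁sub⟩ := mem_nhdsWithin_iff_exists_mem_nhds_inter.mp (hM.and hne)
  refine ⟨V₁ ∩ {s : ℂ | s.re < 1}, inter_mem hV₁ (isOpen_re_lt_one.mem_nhds hs₀),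
    inter_subset_right, fun z hz => ?_, M, fun z hz => ?_⟩
  · exact (hV₁sub ⟨hz.1.1, hz.2⟩).2
  · exact (hV₁sub ⟨hz.1.1, hz.2⟩).1

/-- **The continuation on `U`**: there is `Ẽ` holomorphic on `U = {Re s < 1}` with `K₁ Ẽ = G₁` on `U`
and `Ẽ = F` on the strip `a < Re s < 1` (Beurling 1953: "`F(s)` coincides with `G(s)/K(s)` in the
strip … the latter function can have no singularities other than isolated poles in `σ ≤ 1/p`", and
under the zero-free hypothesis there are none). [cite: Beurling1953, proof of Theorem I (meromorphic continuation of F)] -/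
theorem exists_continuation {a : ℝ} (ha1 : a < 1) {g : ℝ → ℝ} (hgm : Measurable g)
    (hg : IntegrableOn g (Ioo (0 : ℝ) 1))
    (hgw : ∀ σ : ℝ, a < σ → IntegrableOn (fun x : ℝ => x ^ (σ - 1) * |g x|) (Ioo (0 : ℝ) 1))
    (hann : ∀ θ ξ : ℝ, 0 < θ → θ ≤ 1 → 0 < ξ → ξ ≤ 1 →
      ∫ u in Ioo (0 : ℝ) 1, ((twoPoint θ (u / ξ) : ℝ) : ℂ) * (g u : ℂ) = 0)
    (hrate : ∃ C κ : ℝ, κ < 1 ∧ ∀ σ : ℝ, a < σ → σ ≤ a + 1 →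
      ∫ x in Ioo (0 : ℝ) 1, x ^ (σ - 1) * |g x| ≤ C * (σ - a) ^ (-κ))
    (hZ : ∀ w : ℂ, 1 - a < w.re → riemannZeta w ≠ 0) :
    ∃ Et : ℂ → ℂ, DifferentiableOn ℂ Et {s : ℂ | s.re < 1} ∧
      (∀ s : ℂ, s.re < 1 → twoPointMellin (Real.exp (-1)) s * Et s = corrMellin (Real.exp (-1)) g s) ∧
      ∀ s : ℂ, a < s.re → s.re < 1 → Et s = genMellin g s := by
  obtain ⟨h10, h11⟩ := theta_one_mem
  have hann1 : ∀ ξ : ℝ, 0 < ξ → ξ ≤ 1 →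
      ∫ u in Ioo (0 : ℝ) 1, ((twoPoint (Real.exp (-1)) (u / ξ) : ℝ) : ℂ) * (g u : ℂ) = 0 :=
    fun ξ => hann _ ξ h10 h11.le
  set K : ℂ → ℂ := twoPointMellin (Real.exp (-1)) with hKdef
  set G : ℂ → ℂ := corrMellin (Real.exp (-1)) g with hGdef
  set Q : ℂ → ℂ := fun z => G z / K z with hQ
  have hKd : DifferentiableOn ℂ K {s : ℂ | s.re < 1} := differentiableOn_twoPointMellin _
  have hGd : DifferentiableOn ℂ G {s : ℂ | s.re < 1} :=
    differentiableOn_corrMellin h10.le h11.le hgm hg hann1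
  -- `Q` is continuous (indeed holomorphic) where `K ≠ 0`
  have hQc : ∀ z : ℂ, z.re < 1 → K z ≠ 0 → ContinuousAt Q z := fun z hz hKz =>
    ((hGd.differentiableAt (isOpen_re_lt_one.mem_nhds hz)).continuousAt).div
      ((hKd.differentiableAt (isOpen_re_lt_one.mem_nhds hz)).continuousAt) hKz
  set Et : ℂ → ℂ := fun s => limUnder (𝓝[≠] s) Q with hEt
  -- `Et = Q` where `K ≠ 0`
  have hEtQ : ∀ z : ℂ, z.re < 1 → K z ≠ 0 → Et z = Q z := fun z hz hKz =>
    ((hQc z hz hKz).tendsto.mono_left nhdsWithin_le_nhds).limUnder_eq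
  -- differentiability
  have hdiff : DifferentiableOn ℂ Et {s : ℂ | s.re < 1} := by
    intro s₀ hs₀
    obtain ⟨V, hV, hVU, hVne, M, hVM⟩ := exists_nhds_bdd ha1 hgm hg hgw hann hrate hZ hs₀
    have hQd : DifferentiableOn ℂ Q (V \ {s₀}) := by
      intro z hz
      have hzU : z.re < 1 := hVU hz.1
      exact (((hGd.differentiableAt (isOpen_re_lt_one.mem_nhds hzU)).div
        (hKd.differentiableAt (isOpen_re_lt_one.mem_nhds hzU)) (hVne z hz))).differentiableWithinAt
    have hB : BddAbove (norm ∘ Q '' (V \ {s₀})) := by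
      refine ⟨M, ?_⟩
      rintro _ ⟨z, hz, rfl⟩
      exact hVM z hz
    have hW := Complex.differentiableOn_update_limUnder_of_bddAbove hV hQd hB
    have heq : EqOn Et (Function.update Q s₀ (limUnder (𝓝[≠] s₀) Q)) V := by
      intro z hz
      by_cases hzs : z = s₀
      · rw [hzs, Function.update_self]
      · rw [Function.update_of_ne hzs, hEtQ z (hVU hz) (hVne z ⟨hz, hzs⟩)]
    exact ((hW.congr heq).differentiableAt hV).differentiableWithinAt
  refine ⟨Et, hdiff, fun s hs => ?_, fun s has hs1 => ?_⟩
  · -- `K Et = G` on `U`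
    by_cases hKs : K s = 0
    · have h1 : Tendsto (fun z => K z * Et z) (𝓝[≠] s) (𝓝 (K s * Et s)) :=
        ((((hKd.differentiableAt (isOpen_re_lt_one.mem_nhds hs)).continuousAt).mul
          ((hdiff.differentiableAt (isOpen_re_lt_one.mem_nhds hs)).continuousAt)).tendsto).mono_left
          nhdsWithin_le_nhds
      have h2 : Tendsto G (𝓝[≠] s) (𝓝 (G s)) :=
        (((hGd.differentiableAt (isOpen_re_lt_one.mem_nhds hs)).continuousAt).tendsto).mono_left
          nhdsWithin_le_nhds
      have h3 : (fun z => K z * Et z) =ᶠ[𝓝[≠] s] G := by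
        filter_upwards [eventually_ne_zero_twoPointMellin h10 h11 hs,
          mem_nhdsWithin_of_mem_nhds (isOpen_re_lt_one.mem_nhds hs)] with z hz hzU
        rw [hEtQ z hzU hz, hQ]
        exact mul_div_cancel₀ _ hz
      exact tendsto_nhds_unique_of_eventuallyEq h1 h2 h3
    · rw [hEtQ s hs hKs, hQ]
      exact mul_div_cancel₀ _ hKs
  · -- `Et = F` on the strip: both are limits of `Q` along the punctured neighbourhood
    have hS : {z : ℂ | a < z.re ∧ z.re < 1} ∈ 𝓝 s :=
      ((isOpen_lt continuous_const Complex.continuous_re).inter isOpen_re_lt_one).mem_nhds ⟨has, hs1⟩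
    have h1 : Tendsto Et (𝓝[≠] s) (𝓝 (Et s)) :=
      (((hdiff.differentiableAt (isOpen_re_lt_one.mem_nhds hs1)).continuousAt).tendsto).mono_left
        nhdsWithin_le_nhds
    have h2 : Tendsto (genMellin g) (𝓝[≠] s) (𝓝 (genMellin g s)) :=
      ((((differentiableOn_genMellin hgm hgw).differentiableAt
        ((isOpen_lt continuous_const Complex.continuous_re).mem_nhds has)).continuousAt).tendsto).mono_left
        nhdsWithin_le_nhds
    have h3 : Et =ᶠ[𝓝[≠] s] genMellin g := by
      filter_upwards [eventually_ne_zero_twoPointMellin h10 h11 hs1,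
        mem_nhdsWithin_of_mem_nhds hS] with z hz hzS
      rw [hEtQ z hzS.2 hz, hQ]
      simp only
      rw [hGdef, corrMellin_eq_mul h10.le h11.le hgm hzS.2 (hgw _ hzS.1), mul_div_cancel_left₀ _ hz]
    exact tendsto_nhds_unique_of_eventuallyEq h1 h2 h3

/-- **The entire function `E`** extending `F`: `E = F` on `Re s > a` and `K₁ E = G₁` on `Re s < 1`
(Beurling 1953, the second alternative: "`F(s)` is entire").
[cite: Beurling1953, proof of Theorem I ("secondly, F(s) is entire")] -/
theorem exists_entire {a : ℝ} (ha1 : a < 1) {g : ℝ → ℝ} (hgm : Measurable g)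
    (hg : IntegrableOn g (Ioo (0 : ℝ) 1))
    (hgw : ∀ σ : ℝ, a < σ → IntegrableOn (fun x : ℝ => x ^ (σ - 1) * |g x|) (Ioo (0 : ℝ) 1))
    (hann : ∀ θ ξ : ℝ, 0 < θ → θ ≤ 1 → 0 < ξ → ξ ≤ 1 →
      ∫ u in Ioo (0 : ℝ) 1, ((twoPoint θ (u / ξ) : ℝ) : ℂ) * (g u : ℂ) = 0)
    (hrate : ∃ C κ : ℝ, κ < 1 ∧ ∀ σ : ℝ, a < σ → σ ≤ a + 1 →
      ∫ x in Ioo (0 : ℝ) 1, x ^ (σ - 1) * |g x| ≤ C * (σ - a) ^ (-κ))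
    (hZ : ∀ w : ℂ, 1 - a < w.re → riemannZeta w ≠ 0) :
    ∃ E : ℂ → ℂ, Differentiable ℂ E ∧ (∀ s : ℂ, a < s.re → E s = genMellin g s) ∧
      ∀ s : ℂ, s.re < 1 → twoPointMellin (Real.exp (-1)) s * E s = corrMellin (Real.exp (-1)) g s := by
  obtain ⟨Et, hEtd, hEtK, hEtF⟩ := exists_continuation ha1 hgm hg hgw hann hrate hZ
  classical
  set E : ℂ → ℂ := fun s => if a < s.re then genMellin g s else Et s with hE
  have hEF : ∀ s : ℂ, a < s.re → E s = genMellin g s := fun s hs => by simp [hE, hs]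
  have hEEt : ∀ s : ℂ, s.re < 1 → E s = Et s := fun s hs => by
    by_cases h : a < s.re
    · rw [hEF s h, hEtF s h hs]
    · simp [hE, h]
  refine ⟨E, fun s => ?_, hEF, fun s hs => by rw [hEEt s hs, hEtK s hs]⟩
  by_cases h : a < s.re
  · have hopen : IsOpen {z : ℂ | a < z.re} := isOpen_lt continuous_const Complex.continuous_re
    have hev : E =ᶠ[𝓝 s] genMellin g := by
      filter_upwards [hopen.mem_nhds h] with z hz using hEF z hz
    exact (((differentiableOn_genMellin hgm hgw).differentiableAt (hopen.mem_nhds h)).congr_of_eventuallyEq hev)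
  · have hs1 : s.re < 1 := by linarith [not_lt.mp h]
    have hev : E =ᶠ[𝓝 s] Et := by
      filter_upwards [isOpen_re_lt_one.mem_nhds hs1] with z hz using hEEt z hz
    exact ((hEtd.differentiableAt (isOpen_re_lt_one.mem_nhds hs1)).congr_of_eventuallyEq hev)


/-! ## §5 Growth of `E` and the conclusion (Beurling 1953 (5): `F` bounded ⇒ `F ≡ 0` by Liouville) -/

/-- Monotonicity of the weighted `L¹` norms: `∫₀¹ x^{σ−1}|g| ≤ ∫₀¹ x^{σ'−1}|g|` for `σ' ≤ σ`.
[folklore] -/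
private theorem weighted_integral_antitone {g : ℝ → ℝ} {σ σ' : ℝ} (hle : σ' ≤ σ)
    (h' : IntegrableOn (fun x : ℝ => x ^ (σ' - 1) * |g x|) (Ioo (0 : ℝ) 1))
    (h : IntegrableOn (fun x : ℝ => x ^ (σ - 1) * |g x|) (Ioo (0 : ℝ) 1)) :
    ∫ x in Ioo (0 : ℝ) 1, x ^ (σ - 1) * |g x| ≤ ∫ x in Ioo (0 : ℝ) 1, x ^ (σ' - 1) * |g x| := by
  refine setIntegral_mono_on h h' measurableSet_Ioo fun x hx => ?_
  exact mul_le_mul_of_nonneg_right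
    (Real.rpow_le_rpow_of_exponent_ge hx.1 hx.2.le (by linarith)) (abs_nonneg _)

/-- `0 < θ₁ − θ₁²` for `θ₁ = e^{-1}`. [folklore] -/
private theorem theta_one_sub_sq_pos : 0 < Real.exp (-1) - Real.exp (-1) ^ (2 : ℝ) := by
  obtain ⟨h10, h11⟩ := theta_one_mem
  have : Real.exp (-1) ^ (2 : ℝ) < Real.exp (-1) ^ (1 : ℝ) :=
    Real.rpow_lt_rpow_of_exponent_gt h10 h11 (by norm_num)
  rw [Real.rpow_one] at this; linarith

/-- **The direct bound left of `Re s = −1`**: for `Re s ≤ −1`,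
`‖G₁(s)/K₁(s)‖ ≤ 2‖g‖₁ ζ(2) ‖1 − s‖ / ((θ₁ − θ₁²)(1 − Re s))` (explicit lower bound for `K₁`,
upper bound for `G₁`). [cite: Beurling1953, proof of Theorem I, eq. (5)] -/
theorem norm_div_le_of_re_le_neg_one {g : ℝ → ℝ} (hg : IntegrableOn g (Ioo (0 : ℝ) 1))
    (hann : ∀ ξ : ℝ, 0 < ξ → ξ ≤ 1 →
      ∫ u in Ioo (0 : ℝ) 1, ((twoPoint (Real.exp (-1)) (u / ξ) : ℝ) : ℂ) * (g u : ℂ) = 0)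
    {s : ℂ} (hs : s.re ≤ -1) :
    ‖corrMellin (Real.exp (-1)) g s / twoPointMellin (Real.exp (-1)) s‖ ≤
      2 * (∫ u in Ioo (0 : ℝ) 1, |g u|) * ‖riemannZeta ((2 : ℝ) : ℂ)‖ * ‖1 - s‖ /
        ((Real.exp (-1) - Real.exp (-1) ^ (2 : ℝ)) * (1 - s.re)) := by
  obtain ⟨h10, h11⟩ := theta_one_mem
  have hθpos := theta_one_sub_sq_pos
  set θ : ℝ := Real.exp (-1) with hθ
  have hs0 : s.re < 0 := by linarith
  have hs1 : s.re < 1 := by linarith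
  have hI : 0 ≤ ∫ u in Ioo (0 : ℝ) 1, |g u| := integral_nonneg fun u => abs_nonneg _
  have hG := norm_corrMellin_le h10.le h11.le hg hann hs1
  have hK := norm_twoPointMellin_ge h10 h11.le hs0
  have hθ2 : θ - θ ^ (2 : ℝ) ≤ θ - θ ^ (1 - s.re) := by
    have : θ ^ (1 - s.re) ≤ θ ^ (2 : ℝ) :=
      Real.rpow_le_rpow_of_exponent_ge h10 h11.le (by linarith)
    linarith
  have hApos : 0 ≤ θ - θ ^ (1 - s.re) := hθpos.le.trans hθ2
  have hζ2pos : 0 < ‖riemannZeta ((2 : ℝ) : ℂ)‖ :=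
    lt_of_lt_of_le zero_lt_one (one_le_norm_riemannZeta_ofReal (by norm_num))
  have hratio : 1 / ‖riemannZeta ((2 : ℝ) : ℂ)‖ ≤
      ‖riemannZeta ((2 * (1 - s.re) : ℝ) : ℂ)‖ / ‖riemannZeta ((1 - s.re : ℝ) : ℂ)‖ := by
    have h2σ : 1 ≤ ‖riemannZeta ((2 * (1 - s.re) : ℝ) : ℂ)‖ :=
      one_le_norm_riemannZeta_ofReal (by linarith)
    have hσ : ‖riemannZeta ((1 - s.re : ℝ) : ℂ)‖ ≤ ‖riemannZeta ((2 : ℝ) : ℂ)‖ :=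
      norm_riemannZeta_ofReal_antitone (by norm_num) (by linarith)
    have hσpos : 0 < ‖riemannZeta ((1 - s.re : ℝ) : ℂ)‖ :=
      lt_of_lt_of_le zero_lt_one (one_le_norm_riemannZeta_ofReal (by linarith))
    calc 1 / ‖riemannZeta ((2 : ℝ) : ℂ)‖ ≤ 1 / ‖riemannZeta ((1 - s.re : ℝ) : ℂ)‖ :=
          one_div_le_one_div_of_le hσpos hσ
      _ ≤ _ := by gcongr
  have h1s : 0 < ‖1 - s‖ := by
    have : (1 - s) ≠ 0 := fun h => by
      have := congrArg Complex.re h; simp at this; linarith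
    exact norm_pos_iff.mpr this
  have hKlow : (θ - θ ^ (2 : ℝ)) * (1 / ‖riemannZeta ((2 : ℝ) : ℂ)‖) / ‖1 - s‖ ≤
      ‖twoPointMellin θ s‖ := by
    refine le_trans ?_ hK
    exact div_le_div_of_nonneg_right (mul_le_mul hθ2 hratio (by positivity) hApos) h1s.le
  have hKpos : 0 < ‖twoPointMellin θ s‖ := lt_of_lt_of_le (by positivity) hKlow
  have hden : 0 < 1 - s.re := by linarith
  rw [norm_div, div_le_div_iff₀ hKpos (by positivity)]
  calc ‖corrMellin θ g s‖ * ((θ - θ ^ (2 : ℝ)) * (1 - s.re))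
      ≤ (2 * (∫ u in Ioo (0 : ℝ) 1, |g u|) / (1 - s.re)) * ((θ - θ ^ (2 : ℝ)) * (1 - s.re)) := by
        gcongr
    _ = 2 * (∫ u in Ioo (0 : ℝ) 1, |g u|) * ‖riemannZeta ((2 : ℝ) : ℂ)‖ * ‖1 - s‖ *
          ((θ - θ ^ (2 : ℝ)) * (1 / ‖riemannZeta ((2 : ℝ) : ℂ)‖) / ‖1 - s‖) := by
        field_simp
    _ ≤ 2 * (∫ u in Ioo (0 : ℝ) 1, |g u|) * ‖riemannZeta ((2 : ℝ) : ℂ)‖ * ‖1 - s‖ *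
          ‖twoPointMellin θ s‖ := by
        gcongr

/-- **The bound on the real ray `σ ≤ −1`** for any function `E` with `K₁ E = G₁` on `U`:
`‖E(σ)‖ ≤ 2‖g‖₁ ζ(2)/(θ₁ − θ₁²)`. [cite: Beurling1953, proof of Theorem I, eq. (5)] -/
theorem norm_le_on_ray {g : ℝ → ℝ} (hg : IntegrableOn g (Ioo (0 : ℝ) 1))
    (hann : ∀ ξ : ℝ, 0 < ξ → ξ ≤ 1 →
      ∫ u in Ioo (0 : ℝ) 1, ((twoPoint (Real.exp (-1)) (u / ξ) : ℝ) : ℂ) * (g u : ℂ) = 0)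
    {E : ℂ → ℂ}
    (hEK : ∀ s : ℂ, s.re < 1 → twoPointMellin (Real.exp (-1)) s * E s = corrMellin (Real.exp (-1)) g s)
    {x : ℝ} (hx : x ≤ -1) :
    ‖E (x : ℂ)‖ ≤ 2 * (∫ u in Ioo (0 : ℝ) 1, |g u|) * ‖riemannZeta ((2 : ℝ) : ℂ)‖ /
      (Real.exp (-1) - Real.exp (-1) ^ (2 : ℝ)) := by
  obtain ⟨h10, h11⟩ := theta_one_mem
  have hθpos := theta_one_sub_sq_pos
  have hxre : ((x : ℂ)).re = x := Complex.ofReal_re x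
  have hneg : ((x : ℂ)).re < 0 := by rw [hxre]; linarith
  have hKs : twoPointMellin (Real.exp (-1)) x ≠ 0 := twoPointMellin_ne_zero_of_re_neg h10 h11 hneg
  have hEq : E x = corrMellin (Real.exp (-1)) g x / twoPointMellin (Real.exp (-1)) x := by
    rw [eq_div_iff hKs, mul_comm]; exact hEK x (by linarith)
  have hd := norm_div_le_of_re_le_neg_one hg hann (s := (x : ℂ)) (by rw [hxre]; exact hx)
  rw [← hEq, hxre] at hd
  have h1x : ‖(1 : ℂ) - x‖ = 1 - x := by
    rw [show (1 : ℂ) - x = ((1 - x : ℝ) : ℂ) by push_cast; ring, Complex.norm_real, Real.norm_eq_abs,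
      abs_of_pos (by linarith)]
  rw [h1x] at hd
  refine hd.trans (le_of_eq ?_)
  have : (1 - x) ≠ 0 := by linarith
  field_simp

/-- **The Poisson–Jensen bound in the discs** centred at `c = −1 + it`: for an entire `E` with
`K₁ E = G₁` on `U` and `−1 ≤ Re s ≤ b` (`0 ≤ b < 1`),
`log ‖E(s)‖ ≤ ρ (log⁺ M_g + log⁺ M_h − log c₀ + log ‖1 − c‖)` with explicit `ρ, M_g, M_h, c₀`
depending only on `b`, `‖g‖₁` (this replaces Beurling's appeal to the F. and R. Nevanlinna
factorisation: the kernel `K₁` is explicit). [cite: Beurling1953, proof of Theorem I (the expansion log|K| = U₁+U₂+U₃)] [cite: RubelColliander1996, Ch. 8 Theorem (p. 23)] -/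
theorem log_norm_le_on_disc {g : ℝ → ℝ} (hg : IntegrableOn g (Ioo (0 : ℝ) 1))
    (hann : ∀ ξ : ℝ, 0 < ξ → ξ ≤ 1 →
      ∫ u in Ioo (0 : ℝ) 1, ((twoPoint (Real.exp (-1)) (u / ξ) : ℝ) : ℂ) * (g u : ℂ) = 0)
    {E : ℂ → ℂ} (hEd : Differentiable ℂ E)
    (hEK : ∀ s : ℂ, s.re < 1 → twoPointMellin (Real.exp (-1)) s * E s = corrMellin (Real.exp (-1)) g s)
    {b : ℝ} (hb0 : 0 ≤ b) (hb1 : b < 1) {s : ℂ} (hs1 : -1 ≤ s.re) (hs2 : s.re ≤ b) :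
    Real.log ‖E s‖ ≤ ((((1 + b) + 2) / 2 + (1 + b)) / ((((1 + b) + ((1 + b) + 2) / 2) / 2) - (1 + b))) *
      (log⁺ (2 * (∫ u in Ioo (0 : ℝ) 1, |g u|) / (2 - ((1 + b) + 2) / 2)) +
        log⁺ (2 / (2 - ((1 + b) + 2) / 2)) -
        Real.log ((Real.exp (-1) - Real.exp (-1) ^ (1 - (-1 : ℝ))) *
          (‖riemannZeta ((2 * (1 - (-1 : ℝ)) : ℝ) : ℂ)‖ / ‖riemannZeta ((1 - (-1 : ℝ) : ℝ) : ℂ)‖)) +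
        Real.log ‖1 - (-1 + s.im * I)‖) := by
  obtain ⟨h10, h11⟩ := theta_one_mem
  set θ : ℝ := Real.exp (-1) with hθ
  set N1 : ℝ := ∫ u in Ioo (0 : ℝ) 1, |g u| with hN1
  have hN1 : 0 ≤ N1 := integral_nonneg fun u => abs_nonneg _
  set r : ℝ := 1 + b with hr
  set R₂ : ℝ := (r + 2) / 2 with hR₂
  set R₁ : ℝ := (r + R₂) / 2 with hR₁
  have hr2 : r < 2 := by rw [hr]; linarith
  have hr0 : 0 ≤ r := by rw [hr]; linarith
  have hrR₁ : r < R₁ := by rw [hR₁, hR₂]; linarith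
  have hR₁₂ : R₁ < R₂ := by rw [hR₁, hR₂]; linarith
  have hR₂2 : R₂ < 2 := by rw [hR₂]; linarith
  set c₀ : ℝ := (θ - θ ^ (1 - (-1 : ℝ))) *
    (‖riemannZeta ((2 * (1 - (-1 : ℝ)) : ℝ) : ℂ)‖ / ‖riemannZeta ((1 - (-1 : ℝ) : ℝ) : ℂ)‖) with hc₀
  have hc₀pos : 0 < c₀ := by
    have h1 : 0 < θ - θ ^ (1 - (-1 : ℝ)) := by
      have : θ ^ (1 - (-1 : ℝ)) < θ ^ (1 : ℝ) := Real.rpow_lt_rpow_of_exponent_gt h10 h11 (by norm_num)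
      rw [Real.rpow_one] at this; linarith
    have h2 : 0 < ‖riemannZeta ((2 * (1 - (-1 : ℝ)) : ℝ) : ℂ)‖ :=
      lt_of_lt_of_le zero_lt_one (one_le_norm_riemannZeta_ofReal (by norm_num))
    have h3 : 0 < ‖riemannZeta ((1 - (-1 : ℝ) : ℝ) : ℂ)‖ :=
      lt_of_lt_of_le zero_lt_one (one_le_norm_riemannZeta_ofReal (by norm_num))
    positivity
  set c : ℂ := -1 + s.im * I with hc
  have hcre : c.re = -1 := by simp [hc]
  have hzre : ∀ z ∈ closedBall c R₂, z.re ≤ -1 + R₂ := by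
    intro z hz
    rw [mem_closedBall, dist_eq_norm] at hz
    have := abs_re_le_norm (z - c)
    rw [sub_re, hcre] at this
    have h' := (abs_le.mp (this.trans hz)).2
    linarith
  have hball : ∀ z ∈ closedBall c R₂, z.re < 1 := fun z hz => by linarith [hzre z hz]
  have hKa : AnalyticOnNhd ℂ (twoPointMellin θ) (closedBall c R₂) :=
    fun z hz => analyticOnNhd_twoPointMellin θ z (hball z hz)
  have hEa : AnalyticOnNhd ℂ E (closedBall c R₂) := fun z _ => hEd.analyticAt z
  have hq : ∀ z ∈ closedBall c R₂, E z * twoPointMellin θ z = corrMellin θ g z := by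
    intro z hz; rw [mul_comm]; exact hEK z (hball z hz)
  have hcK : twoPointMellin θ c ≠ 0 := twoPointMellin_ne_zero_of_re_neg h10 h11 (by rw [hcre]; norm_num)
  have h2R : 0 < 2 - R₂ := by linarith
  have hMg' : ∀ z ∈ closedBall c R₂, ‖corrMellin θ g z‖ ≤ 2 * N1 / (2 - R₂) := by
    intro z hz
    refine (norm_corrMellin_le h10.le h11.le hg hann (hball z hz)).trans ?_
    rw [div_le_div_iff₀ (by linarith [hball z hz]) h2R]
    nlinarith [hzre z hz]
  have hMh' : ∀ z ∈ closedBall c R₂, ‖twoPointMellin θ z‖ ≤ 2 / (2 - R₂) := by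
    intro z hz
    refine (norm_twoPointMellin_le h10.le h11.le (hball z hz)).trans ?_
    rw [div_le_div_iff₀ (by linarith [hball z hz]) h2R]
    nlinarith [hzre z hz]
  have hw : s ∈ closedBall c r := by
    rw [mem_closedBall, dist_eq_norm]
    have : s - c = ((s.re + 1 : ℝ) : ℂ) := by
      apply Complex.ext <;> simp [hc]
    rw [this, Complex.norm_real, Real.norm_eq_abs, abs_of_nonneg (by linarith), hr]
    linarith
  have key := log_norm_le_ratio_of_mul_eq hr0 hrR₁ hR₁₂ hKa hEa hq hcK hMg' hMh' hw
  have hKc : c₀ / ‖1 - c‖ ≤ ‖twoPointMellin θ c‖ := by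
    have := norm_twoPointMellin_ge h10 h11.le (s := c) (by rw [hcre]; norm_num)
    rw [hcre] at this
    exact this
  have h1c : 0 < ‖1 - c‖ := by
    have : (1 - c) ≠ 0 := fun h => by
      have := congrArg Complex.re h; simp [hc] at this
    exact norm_pos_iff.mpr this
  have hlogK : Real.log c₀ - Real.log ‖1 - c‖ ≤ Real.log ‖twoPointMellin θ c‖ := by
    rw [← Real.log_div hc₀pos.ne' h1c.ne']
    exact Real.log_le_log (div_pos hc₀pos h1c) hKc
  refine key.trans ?_
  have hρ0 : 0 ≤ (R₂ + r) / (R₁ - r) := div_nonneg (by linarith) (by linarith)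
  refine mul_le_mul_of_nonneg_left ?_ hρ0
  linarith

/-- **Exponential type in the left half-plane `Re s ≤ b`**: for an entire `E` with `K₁ E = G₁` on
`U`, `‖E(s)‖ ≤ A e^{B|s|}` there (discs for `Re s ≥ −1`, the direct quotient bound for `Re s < −1`).
This is Beurling's estimate (5) `|F(σ+it)| ≤ M e^{c(σ−α)}` in the weak form that Phragmén–Lindelöf
needs. [cite: Beurling1953, proof of Theorem I (eq. (5))] -/
theorem norm_le_exp_of_re_le {g : ℝ → ℝ} (hg : IntegrableOn g (Ioo (0 : ℝ) 1))
    (hann : ∀ ξ : ℝ, 0 < ξ → ξ ≤ 1 →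
      ∫ u in Ioo (0 : ℝ) 1, ((twoPoint (Real.exp (-1)) (u / ξ) : ℝ) : ℂ) * (g u : ℂ) = 0)
    {E : ℂ → ℂ} (hEd : Differentiable ℂ E)
    (hEK : ∀ s : ℂ, s.re < 1 → twoPointMellin (Real.exp (-1)) s * E s = corrMellin (Real.exp (-1)) g s)
    {b : ℝ} (hb0 : 0 ≤ b) (hb1 : b < 1) :
    ∃ A B : ℝ, 0 ≤ A ∧ 0 ≤ B ∧ ∀ s : ℂ, s.re ≤ b → ‖E s‖ ≤ A * Real.exp (B * ‖s‖) := by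
  obtain ⟨h10, h11⟩ := theta_one_mem
  have hθpos := theta_one_sub_sq_pos
  set θ : ℝ := Real.exp (-1) with hθ
  set N1 : ℝ := ∫ u in Ioo (0 : ℝ) 1, |g u| with hN1
  have hN1 : 0 ≤ N1 := integral_nonneg fun u => abs_nonneg _
  -- the constants of the disc bound
  set ρ : ℝ := (((1 + b) + 2) / 2 + (1 + b)) / ((((1 + b) + ((1 + b) + 2) / 2) / 2) - (1 + b)) with hρ
  have hρ0 : 0 ≤ ρ := by
    rw [hρ]; exact div_nonneg (by linarith) (by nlinarith)
  set X : ℝ := log⁺ (2 * N1 / (2 - ((1 + b) + 2) / 2)) + log⁺ (2 / (2 - ((1 + b) + 2) / 2)) -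
      Real.log ((θ - θ ^ (1 - (-1 : ℝ))) *
        (‖riemannZeta ((2 * (1 - (-1 : ℝ)) : ℝ) : ℂ)‖ / ‖riemannZeta ((1 - (-1 : ℝ) : ℝ) : ℂ)‖)) with hX
  set A₁ : ℝ := Real.exp (ρ * (X + 2)) with hA₁
  set A₂ : ℝ := 2 * N1 * ‖riemannZeta ((2 : ℝ) : ℂ)‖ / (θ - θ ^ (2 : ℝ)) with hA₂
  have hA₂0 : 0 ≤ A₂ := by positivity
  refine ⟨max A₁ A₂, max ρ 1, le_max_of_le_left (Real.exp_pos _).le,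
    zero_le_one.trans (le_max_right _ _), fun s hs => ?_⟩
  by_cases hs1 : -1 ≤ s.re
  · -- disc regime
    have hlog : Real.log ‖E s‖ ≤ ρ * (X + Real.log ‖1 - (-1 + s.im * I)‖) := by
      have := log_norm_le_on_disc hg hann hEd hEK hb0 hb1 hs1 hs
      rw [hρ, hX]
      convert this using 2
    have him : ‖1 - (-1 + s.im * I)‖ ≤ 2 + ‖s‖ := by
      have : (1 : ℂ) - (-1 + s.im * I) = 2 - s.im * I := by ring
      rw [this]
      refine (norm_sub_le _ _).trans ?_
      have h2 : ‖(2 : ℂ)‖ = 2 := by norm_num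
      rw [h2, norm_mul, Complex.norm_I, mul_one, Complex.norm_real, Real.norm_eq_abs]
      linarith [Complex.abs_im_le_norm s]
    have h2s : 0 < 2 + ‖s‖ := by positivity
    have hlog2 : Real.log ‖1 - (-1 + s.im * I)‖ ≤ 2 + ‖s‖ := by
      by_cases h0 : ‖1 - (-1 + ↑s.im * I)‖ = 0
      · rw [h0, Real.log_zero]; positivity
      · have hpos : 0 < ‖1 - (-1 + ↑s.im * I)‖ := lt_of_le_of_ne (norm_nonneg _) (Ne.symm h0)
        exact (Real.log_le_log hpos him).trans ((Real.log_le_sub_one_of_pos h2s).trans (by linarith))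
    have hX' : Real.log ‖E s‖ ≤ ρ * (X + 2) + ρ * ‖s‖ := by
      have := mul_le_mul_of_nonneg_left hlog2 hρ0
      nlinarith
    have hEs : ‖E s‖ ≤ A₁ * Real.exp (ρ * ‖s‖) := by
      by_cases h0 : ‖E s‖ = 0
      · rw [h0]; positivity
      · have hpos : 0 < ‖E s‖ := lt_of_le_of_ne (norm_nonneg _) (Ne.symm h0)
        rw [hA₁, ← Real.exp_add, ← Real.exp_log hpos]
        exact Real.exp_le_exp.mpr hX'
    refine hEs.trans ?_
    gcongr
    · exact le_max_left _ _
    · exact le_max_left _ _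
  · -- direct regime `Re s < -1`
    rw [not_le] at hs1
    have hKs : twoPointMellin θ s ≠ 0 := twoPointMellin_ne_zero_of_re_neg h10 h11 (by linarith)
    have hEq : E s = corrMellin θ g s / twoPointMellin θ s := by
      rw [eq_div_iff hKs, mul_comm]; exact hEK s (by linarith)
    have hd := norm_div_le_of_re_le_neg_one hg hann hs1.le
    rw [← hEq] at hd
    have h1s : ‖1 - s‖ ≤ 1 + ‖s‖ := by
      refine (norm_sub_le _ _).trans ?_; simp
    have hden : 1 ≤ 1 - s.re := by linarith
    have hEs : ‖E s‖ ≤ A₂ * (1 + ‖s‖) := by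
      refine hd.trans ?_
      rw [hA₂, div_mul_eq_mul_div, div_le_div_iff₀ (by positivity) hθpos]
      calc 2 * N1 * ‖riemannZeta ((2 : ℝ) : ℂ)‖ * ‖1 - s‖ * (θ - θ ^ (2 : ℝ))
          ≤ 2 * N1 * ‖riemannZeta ((2 : ℝ) : ℂ)‖ * (1 + ‖s‖) * (θ - θ ^ (2 : ℝ)) := by gcongr
        _ ≤ 2 * N1 * ‖riemannZeta ((2 : ℝ) : ℂ)‖ * (1 + ‖s‖) * (θ - θ ^ (2 : ℝ)) * (1 - s.re) :=
            le_mul_of_one_le_right (by positivity) hden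
        _ = _ := by ring
    have hexp : 1 + ‖s‖ ≤ Real.exp (max ρ 1 * ‖s‖) := by
      refine (by linarith [Real.add_one_le_exp ‖s‖] : 1 + ‖s‖ ≤ Real.exp ‖s‖).trans ?_
      exact Real.exp_le_exp.mpr (le_mul_of_one_le_left (norm_nonneg _) (le_max_right _ _))
    calc ‖E s‖ ≤ A₂ * (1 + ‖s‖) := hEs
      _ ≤ max A₁ A₂ * Real.exp (max ρ 1 * ‖s‖) := by
          gcongr
          exact le_max_right _ _

/-- **MAIN ANALYTIC LEMMA (Beurling's necessity argument, kernel form).** Let `0 ≤ a < 1`, `g`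
measurable and integrable on `(0,1)` with `∫₀¹ x^{σ−1}|g| < ∞` for all `σ > a` and the boundary rate
`∫₀¹ x^{σ−1}|g| ≤ C (σ − a)^{−κ}` (`κ < 1`) on `(a, a+1]`; suppose `g` annihilates all dilated
two-point Beurling functions `f_θ(u/ξ)` (`0 < θ, ξ ≤ 1`) and `ζ(w) ≠ 0` for `Re w > 1 − a`. Then
`∫₀¹ g = 0`. (Beurling: the Mellin transform `F` of `g` continues to an entire function — no poles
off the line by the zero-free hypothesis and the two-θ trick, none on the line by the growth rate —
of exponential type in the left half-plane `Re s ≤ (a+1)/2` (Poisson–Jensen with the explicit kernel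
`K₁`) and bounded on its boundary line and on the real axis; by Phragmén–Lindelöf and Liouville `E`
is constant, and `F(σ) → 0` gives `F ≡ 0`, in particular `F(1) = ∫₀¹ g = 0`.)
[cite: Beurling1955, Theorem (necessity half), proof pp. 313–314; Beurling 1953 Thm I] -/
theorem integral_eq_zero_of_annihilator {a : ℝ} (ha0 : 0 ≤ a) (ha1 : a < 1) {g : ℝ → ℝ}
    (hgm : Measurable g) (hg : IntegrableOn g (Ioo (0 : ℝ) 1))
    (hgw : ∀ σ : ℝ, a < σ → IntegrableOn (fun x : ℝ => x ^ (σ - 1) * |g x|) (Ioo (0 : ℝ) 1))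
    (hann : ∀ θ ξ : ℝ, 0 < θ → θ ≤ 1 → 0 < ξ → ξ ≤ 1 →
      ∫ u in Ioo (0 : ℝ) 1, ((twoPoint θ (u / ξ) : ℝ) : ℂ) * (g u : ℂ) = 0)
    (hrate : ∃ C κ : ℝ, κ < 1 ∧ ∀ σ : ℝ, a < σ → σ ≤ a + 1 →
      ∫ x in Ioo (0 : ℝ) 1, x ^ (σ - 1) * |g x| ≤ C * (σ - a) ^ (-κ))
    (hZ : ∀ w : ℂ, 1 - a < w.re → riemannZeta w ≠ 0) :
    ∫ x in Ioo (0 : ℝ) 1, g x = 0 := by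
  obtain ⟨h10, h11⟩ := theta_one_mem
  have hann1 : ∀ ξ : ℝ, 0 < ξ → ξ ≤ 1 →
      ∫ u in Ioo (0 : ℝ) 1, ((twoPoint (Real.exp (-1)) (u / ξ) : ℝ) : ℂ) * (g u : ℂ) = 0 :=
    fun ξ => hann _ ξ h10 h11.le
  obtain ⟨E, hEd, hEF, hEK⟩ := exists_entire ha1 hgm hg hgw hann hrate hZ
  -- the dividing abscissa
  set b : ℝ := (a + 1) / 2 with hb
  have hab : a < b := by rw [hb]; linarith
  have hb1 : b < 1 := by rw [hb]; linarith
  have hb0 : 0 ≤ b := by rw [hb]; linarith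
  -- (i) bound on `Re s ≥ b`
  set M₁ : ℝ := ∫ x in Ioo (0 : ℝ) 1, x ^ (b - 1) * |g x| with hM₁
  have hright : ∀ s : ℂ, b ≤ s.re → ‖E s‖ ≤ M₁ := by
    intro s hs
    rw [hEF s (lt_of_lt_of_le hab hs)]
    exact (norm_genMellin_le g s).trans
      (weighted_integral_antitone hs (hgw _ hab) (hgw _ (lt_of_lt_of_le hab hs)))
  -- (ii) exponential type on `Re s ≤ b`, (iii) boundedness on the ray
  obtain ⟨A, B, hA, hB, hAB⟩ := norm_le_exp_of_re_le hg hann1 hEd hEK hb0 hb1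
  set Mray : ℝ := 2 * (∫ u in Ioo (0 : ℝ) 1, |g u|) * ‖riemannZeta ((2 : ℝ) : ℂ)‖ /
      (Real.exp (-1) - Real.exp (-1) ^ (2 : ℝ)) with hMray
  have hray : ∀ x : ℝ, x ≤ -1 → ‖E (x : ℂ)‖ ≤ Mray := fun x hx => norm_le_on_ray hg hann1 hEK hx
  -- (iv) Phragmén–Lindelöf in the half-plane `Re s ≤ b`, written as `z = b - s`, `Re z ≥ 0`
  set f : ℂ → ℂ := fun z => E ((b : ℂ) - z) with hf
  have hfd : Differentiable ℂ f := hEd.comp ((differentiable_const _).sub differentiable_id)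
  have hsre : ∀ z : ℂ, ((b : ℂ) - z).re = b - z.re := fun z => by
    rw [Complex.sub_re, Complex.ofReal_re]
  have hPL : ∀ z : ℂ, 0 ≤ z.re → ‖f z‖ ≤ M₁ := by
    intro z hz
    refine PhragmenLindelof.right_half_plane_of_bounded_on_real hfd.diffContOnCl ?_ ?_ ?_ hz
    · refine ⟨1, by norm_num, B, ?_⟩
      refine Asymptotics.IsBigO.of_bound (A * Real.exp (B * b)) ?_
      have hmem : {z : ℂ | 0 < z.re} ∈ Bornology.cobounded ℂ ⊓ 𝓟 {z : ℂ | 0 < z.re} :=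
        mem_inf_of_right (mem_principal_self _)
      filter_upwards [hmem] with z hz
      have hz' : 0 < z.re := hz
      have hle : ((b : ℂ) - z).re ≤ b := by rw [hsre]; linarith
      refine (hAB _ hle).trans ?_
      rw [Real.norm_eq_abs, abs_of_pos (Real.exp_pos _), Real.rpow_one, mul_assoc, ← Real.exp_add]
      refine mul_le_mul_of_nonneg_left (Real.exp_le_exp.mpr ?_) hA
      calc B * ‖(b : ℂ) - z‖ ≤ B * (‖(b : ℂ)‖ + ‖z‖) :=
            mul_le_mul_of_nonneg_left (norm_sub_le _ _) hB
        _ = B * b + B * ‖z‖ := by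
            rw [Complex.norm_real, Real.norm_eq_abs, abs_of_nonneg hb0]; ring
    · refine Filter.isBoundedUnder_of_eventually_le (a := Mray) ?_
      filter_upwards [eventually_ge_atTop (b + 1)] with x hx
      have : f x = E (((b - x : ℝ)) : ℂ) := by
        simp only [hf, Complex.ofReal_sub]
      rw [this]
      exact hray _ (by linarith)
    · intro x
      have hre : ((b : ℂ) - x * I).re = b := by
        rw [Complex.sub_re, Complex.ofReal_re, Complex.mul_re, Complex.I_re, Complex.I_im,
          Complex.ofReal_re, Complex.ofReal_im]; ring
      exact hright _ (le_of_eq hre.symm)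
  -- (v) `E` is bounded, hence constant (Liouville)
  have hbound : ∀ s : ℂ, ‖E s‖ ≤ M₁ := by
    intro s
    by_cases hs : b ≤ s.re
    · exact hright s hs
    · have h1 := hPL ((b : ℂ) - s) (by rw [hsre]; linarith [not_le.mp hs])
      have h2 : f ((b : ℂ) - s) = E s := by simp only [hf, sub_sub_cancel]
      rw [h2] at h1
      exact h1
  have hconst : ∀ s : ℂ, E s = E 1 := fun s =>
    hEd.apply_eq_apply_of_bounded (isBounded_iff_forall_norm_le.mpr ⟨M₁, by
      rintro _ ⟨s, rfl⟩; exact hbound s⟩) s 1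
  -- (vi) `F(σ) → 0`, `F = E = const` on `σ > a`, so `F(1) = 0`
  have hlim := tendsto_genMellin_atTop hg
  have hev : (fun σ : ℝ => genMellin g (σ : ℂ)) =ᶠ[atTop] fun _ => genMellin g 1 := by
    filter_upwards [eventually_gt_atTop a] with σ hσ
    have h1 : a < ((σ : ℂ)).re := by rw [Complex.ofReal_re]; exact hσ
    have h2 : a < (1 : ℂ).re := by rw [Complex.one_re]; exact ha1
    rw [← hEF σ h1, hconst, hEF 1 h2]
  have h0 : genMellin g 1 = 0 :=
    tendsto_nhds_unique (tendsto_const_nhds.congr' hev.symm) hlim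
  rw [genMellin_one] at h0
  have : ((∫ x in Ioo (0 : ℝ) 1, g x : ℝ) : ℂ) = 0 := by
    rw [← h0, ← integral_complex_ofReal]
  exact_mod_cast this

end Beurling1955

end Literature.NumberTheory.LFunctions

end
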